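import Summits.NavierStokesRegularity.NavierStokesRegularity.Theorems.RecurrentProfilesRecurrentReductionOrbit
import Summits.NavierStokesRegularity.NavierStokesRegularity.Theorems.RecurrentProfilesRecurrentLiouvilleSmGenericRecurrentPoint
import Summits.NavierStokesRegularity.NavierStokesRegularity.Theorems.SqueezeCycleRecurrentLiouvilleNearIdentityDSS
import Literature.Analysis.FluidPDE.ScalingRecurrentSlabField
import Mathlib.Topology.ContinuousMap.Bounded.Basic
import HarnessLib

/-!
# Crux `RecurrentLiouville` (stmt-NavierStokesRegularity-1589), line `Sketch` v10 — stub SM4: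
# the GENERIC RECURRENT REDUCTION in the Albritton–Barker class

`stub_smGenericReduction` (lead c12): if a suitable weak solution `(u, p)` of Navier–Stokes
(`ν = 1`, `f = 0`) on the backward slab `ℝ₋ × ℝ³` with weak gradient `G`, Albritton–Barker
quantity `𝐈 < ∞` and the Type-I rate `‖u(t,x)‖ ≤ C/√(−t)` is singular at the origin, then there is
a profile `w` of the same class (same `C`), singular at the origin, UNIFORMLY RECURRENT under the
scaling `σ ↦ w_{e^σ}` in `L³_loc({t ≤ 0} × ℝ³)`, and GENERIC along the backward log-scales: for
every `n` and every bounded functional `Ψ` of fields that is continuous for the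
`L³(Q(0, n+1))`-seminorm, the Cesàro averages `(1/N) ∑_{k<N} Ψ (w_{e^{-k}})` converge.  All
`L³_loc` statistics of the blow-up sequence `(w_{e^{-k}})_k` exist: the empirical measures of the
backward scaling orbit of `w` converge to a scaling-invariant law — the orbit form of a Type-I
STATIONARY STATISTICAL SOLUTION of Leray's similarity equations (the crux docstring's tool (b),
Krylov–Bogolyubov measures on the hull, in the tree's vocabulary).  Strengthens item 1590
`RecurrentReduction` in the statistical direction.

Proof.  MODEL (the model of `recurrentReduction_proof` / `stub_prProximalReduction`): the
`L³_loc` slab-field space `Literature.Analysis.FluidPDE.SlabField ℝ³ ℝ³ 3` (fields lying in every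
`L³(Q(0, R))`, Fréchet topology of the seminorms `L³(Q(0, n+1))`, pseudo-metrisable) with its
scaling flow `SlabField.flow σ w = w_{e^σ}` (continuous maps, action law, `flow 0 = id`); `S` =
the orbit closure of `u`, compact (`SlabField.isCompact_closure_orbit`) by the tree's engine
`exists_orbit_limit` (Albritton–Barker compactness + persistence of singularities).  ABSTRACT DYNAMICS (`stub_smGenericRecurrentPoint`,
file `…SmGenericRecurrentPoint.lean`: separation quotient of `S`, minimal set of the backward unit
step, ergodic measure, generic point, two-sidedness, lift): a uniformly recurrent point `y ∈ S` of
the flow, generic along the backward unit steps for every bounded continuous observable on `X`.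
DICTIONARY: the field of `y` is uniformly recurrent under scaling
(`SlabField.isUniformlyRecurrentPt_iff`).  IDENTIFICATION (as in item 1590): `y` is an
`L³_loc` limit of orbit points, hence a.e. equal (`SlabField.ae_eq_of_tendsto`) to an engine limit — a suitable weak solution with
`𝐈 < ∞`, singular origin, rate a.e. — and to its pointwise-rate representative `w`
(`exists_rate_profile_repr`).  STATISTICS: a bounded seminorm-continuous functional `Ψ` of fields
induces a bounded continuous observable `s ↦ Ψ s` (`SlabField.continuous_comp_toFun`) and does not
see null sets of the slab, so
`Ψ (w_{e^{-k}}) = Ψ ((ϕ (−k) y))` for every `k` and the Cesàro averages converge by genericity.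

## References

* M. Einsiedler, T. Ward, *Functional Analysis, Spectral Theory, and Applications*, GTM 276
  (2017), Prop. 8.36, Thm. 8.80. [EinsiedlerWard2017]
* H. Furstenberg, *Recurrence in Ergodic Theory and Combinatorial Number Theory* (1981), Ch. 1 §4,
  Thms 1.15–1.17. [Furstenberg1981]
* D. Albritton, T. Barker, J. Math. Fluid Mech. 21 (2019), no. 43 = arXiv:1811.00502, Lemma 2.2,
  Prop. 2.3, §3. [AlbrittonBarker2019]
-/

noncomputable section

-- the sub-problem namespace repeats the summit name (D-0017 layout `Summit.<S>.<P>.Theorems`)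
set_option linter.dupNamespace false

namespace Summit.NavierStokesRegularity.NavierStokesRegularity.Theorems

open MeasureTheory Set Function Filter Topology TopologicalSpace Metric
open Literature.Analysis.FluidPDE
open Literature.Dynamics.TopologicalDynamics
open scoped NNReal ENNReal BoundedContinuousFunction

/-! ### The generic recurrent reduction -/

/-- **SM4 · GENERIC RECURRENT REDUCTION** (registered stub of line `Sketch`, skeleton v10;
strengthening of item 1590 `RecurrentReduction` in the statistical direction).  If a suitable weak
solution `(u, p)` of Navier–Stokes (`ν = 1`) on `ℝ³ × ℝ₋` with weak gradient `G`, `𝐈 < ⊤` and the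
rate `‖u(t,x)‖ ≤ C/√(−t)` is singular at the origin, then there is a profile `w` of the same class
(same `C`), singular at the origin, UNIFORMLY RECURRENT under scaling, and GENERIC along the
backward log-scales: for every `n` and every bounded functional `Ψ` of fields, continuous for the
`L³(Q(0, n+1))`-seminorm, the Cesàro averages `(1/N) ∑_{k<N} Ψ (w_{e^{-k}})` converge (all `L³_loc`
statistics of the blow-up sequence exist).  Proof: the `L³_loc` slab-field model `SlabField ℝ³ ℝ³ 3`
of item 1590, a generic uniformly recurrent point of the compact orbit closure
(`SlabField.isCompact_closure_orbit`, `stub_smGenericRecurrentPoint`), the dictionary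
`SlabField.isUniformlyRecurrentPt_iff`, identification with an engine limit and its rate
representative (`SlabField.ae_eq_of_tendsto`), and invisibility of null sets of the slab for
seminorm-continuous functionals (`SlabField.continuous_comp_toFun`; see the module docstring). [cite: AlbrittonBarker2019, Lemma 2.2, Prop. 2.3] -/
theorem stub_smGenericReduction :
    ∀ (u : ℝ → EuclideanSpace ℝ (Fin 3) → EuclideanSpace ℝ (Fin 3))
      (p : ℝ → EuclideanSpace ℝ (Fin 3) → ℝ)
      (G : ℝ → EuclideanSpace ℝ (Fin 3) → EuclideanSpace ℝ (Fin 3) →L[ℝ] EuclideanSpace ℝ (Fin 3))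
      (C : ℝ),
      IsSuitableWeakSolutionOn (slab (EuclideanSpace ℝ (Fin 3)) (Iio 0) isOpen_Iio) 1 0 u p →
      HasWeakSpatialGradientOn (slab (EuclideanSpace ℝ (Fin 3)) (Iio 0) isOpen_Iio) u G →
      typeIBound (Iio (0 : ℝ) ×ˢ univ) u p G < ⊤ →
      HasTypeITimeDecay C u →
      IsBackwardSingularPoint u 0 →
      ∃ (w : ℝ → EuclideanSpace ℝ (Fin 3) → EuclideanSpace ℝ (Fin 3))
        (q : ℝ → EuclideanSpace ℝ (Fin 3) → ℝ)
        (H : ℝ → EuclideanSpace ℝ (Fin 3) → EuclideanSpace ℝ (Fin 3) →L[ℝ] EuclideanSpace ℝ (Fin 3)),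
        IsSuitableWeakSolutionOn (slab (EuclideanSpace ℝ (Fin 3)) (Iio 0) isOpen_Iio) 1 0 w q ∧
        HasWeakSpatialGradientOn (slab (EuclideanSpace ℝ (Fin 3)) (Iio 0) isOpen_Iio) w H ∧
        typeIBound (Iio (0 : ℝ) ×ˢ univ) w q H < ⊤ ∧
        HasTypeITimeDecay C w ∧
        IsBackwardSingularPoint w 0 ∧
        IsScalingUniformlyRecurrent w ∧
        ∀ (n : ℕ) (Ψ : (ℝ → EuclideanSpace ℝ (Fin 3) → EuclideanSpace ℝ (Fin 3)) → ℝ),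
          (∃ B : ℝ, ∀ v, |Ψ v| ≤ B) →
          (∀ v, ∀ ε : ℝ, 0 < ε → ∃ δ : ℝ, 0 < δ ∧ ∀ v',
            eLpNorm (fun z : ℝ × EuclideanSpace ℝ (Fin 3) => v' z.1 z.2 - v z.1 z.2) 3
              (volume.restrict (parabolicCylinder ((n : ℝ) + 1)
                (0 : ℝ × EuclideanSpace ℝ (Fin 3)))) ≤ ENNReal.ofReal δ →
            |Ψ v' - Ψ v| ≤ ε) →
          ∃ c : ℝ, Tendsto (fun N : ℕ => (N : ℝ)⁻¹ *
            ∑ k ∈ Finset.range N, Ψ (nsRescale (Real.exp (-(k : ℝ))) w)) atTop (𝓝 c) := by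
  intro u p G C hsw hwg hI hdec hsing
  classical
  haveI h13 : Fact (1 ≤ (3 : ℝ≥0∞)) := ⟨by norm_num⟩
  -- `0 ≤ C`
  have hC0 : 0 ≤ C := by
    have h := hdec (-1) (by norm_num) 0
    have h1 : (0 : ℝ) ≤ C / Real.sqrt (-(-1 : ℝ)) := (norm_nonneg _).trans h
    rw [neg_neg, Real.sqrt_one, div_one] at h1
    exact h1
  -- ## the model: `u` as a point of the `L³_loc` slab-field space `SlabField ℝ³ ℝ³ 3`
  let x₀ : SlabField (EuclideanSpace ℝ (Fin 3)) (EuclideanSpace ℝ (Fin 3)) 3 :=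
    SlabField.ofMemLp u fun R hR => memLp_three_of_slabProfile hwg hI hR
  -- ## KEY: subsequential limits of orbit sequences (the engine)
  have hkey : ∀ σs : ℕ → ℝ,
      ∃ (a : SlabField (EuclideanSpace ℝ (Fin 3)) (EuclideanSpace ℝ (Fin 3)) 3) (ψ : ℕ → ℕ),
      StrictMono ψ ∧ Tendsto (fun j => SlabField.flow (σs (ψ j)) x₀) atTop (𝓝 a) ∧
      ∃ (q : ℝ → EuclideanSpace ℝ (Fin 3) → ℝ)
        (H : ℝ → EuclideanSpace ℝ (Fin 3) → EuclideanSpace ℝ (Fin 3) →L[ℝ] EuclideanSpace ℝ (Fin 3)),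
        IsSuitableWeakSolutionOn (slab (EuclideanSpace ℝ (Fin 3)) (Iio 0) isOpen_Iio) 1 0 a.toFun q ∧
        HasWeakSpatialGradientOn (slab (EuclideanSpace ℝ (Fin 3)) (Iio 0) isOpen_Iio) a.toFun H ∧
        typeIBound (Iio (0 : ℝ) ×ˢ univ) a.toFun q H < ⊤ ∧ IsBackwardSingularPoint a.toFun 0 ∧
        (∀ᵐ z ∂(volume.restrict (Iio (0 : ℝ) ×ˢ (univ : Set (EuclideanSpace ℝ (Fin 3))))),
          ‖a.toFun z.1 z.2‖ ≤ C / Real.sqrt (-z.1)) := by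
    intro σs
    obtain ⟨u', p', H', ψ, hψ, hsw', hwg', hI', hsing', hrate', hconv'⟩ :=
      exists_orbit_limit hsw hwg hI hsing hdec (fun k => Real.exp (σs k)) (fun k => Real.exp_pos _)
    have hI'' : typeIBound (Iio (0 : ℝ) ×ˢ univ) u' p' H' < ⊤ :=
      lt_of_le_of_lt hI' (ENNReal.mul_lt_top (by simp) hI)
    refine ⟨SlabField.ofMemLp u' fun R hR => memLp_three_of_slabProfile hwg' hI'' hR, ψ, hψ, ?_,
      p', H', hsw', hwg', hI'', hsing', hrate'⟩
    rw [SlabField.tendsto_flow_iff_forall]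
    exact hconv'
  -- ## the orbit closure: invariant and compact (Albritton–Barker compactness fed to the model)
  set S : Set (SlabField (EuclideanSpace ℝ (Fin 3)) (EuclideanSpace ℝ (Fin 3)) 3) :=
    closure (range fun σ => SlabField.flow σ x₀) with hS
  have hScpt : IsCompact S :=
    x₀.isCompact_closure_orbit fun σs => by
      obtain ⟨a, ψ, hψ, ha, -⟩ := hkey σs
      exact ⟨a, ψ, hψ, ha⟩
  -- ## the abstract dynamics: a GENERIC uniformly recurrent point of `S`
  obtain ⟨y, hyS, hrecy, hgen⟩ :=
    stub_smGenericRecurrentPoint SlabField.continuous_flow SlabField.flow_add SlabField.flow_zero hScpt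
      ⟨x₀, x₀.mem_closure_orbit_self⟩ (SlabField.mapsTo_flow_closure_orbit (w := x₀))
  -- ## the dictionary: the field of `y` is uniformly recurrent under scaling
  have hrecF : IsScalingUniformlyRecurrent y.toFun := (SlabField.isUniformlyRecurrentPt_iff y).1 hrecy
  -- ## identification of `y` with an engine limit, up to a null set of the slab
  obtain ⟨xs, hxs, hxa⟩ := mem_closure_iff_seq_limit.1 hyS
  choose τs hτs using hxs
  obtain ⟨b, ψ, hψ, hb, q, H, hswb, hwgb, hIb, hsingb, hrateb⟩ := hkey τs
  have hxa' : Tendsto (fun j => SlabField.flow (τs (ψ j)) x₀) atTop (𝓝 y) :=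
    (hxa.comp hψ.tendsto_atTop).congr fun j => (hτs (ψ j)).symm
  have hab := SlabField.ae_eq_of_tendsto hb hxa'
  -- ## the pointwise rate: modification on a null set of the slab
  obtain ⟨w, hbw, hsww, hwgw, hIw, hdecw, hsingw⟩ :=
    exists_rate_profile_repr hC0 hswb hwgb hIb hsingb hrateb
  have hyw : ∀ᵐ z ∂(volume.restrict (Iio (0 : ℝ) ×ˢ (univ : Set (EuclideanSpace ℝ (Fin 3))))),
      y.toFun z.1 z.2 = w z.1 z.2 := by
    filter_upwards [hab, hbw] with z hz hz'
    exact hz.symm.trans hz'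
  have hrecw : IsScalingUniformlyRecurrent w := hrecF.congr_ae hyw
  refine ⟨w, q, H, hsww, hwgw, hIw, hdecw, hsingw, hrecw, fun n Ψ hB hΨ => ?_⟩
  -- ## statistics: `Ψ` induces a bounded continuous observable on the slab-field space
  obtain ⟨B, hB⟩ := hB
  have hΨcont : Continuous fun s : SlabField (EuclideanSpace ℝ (Fin 3)) (EuclideanSpace ℝ (Fin 3)) 3 =>
      Ψ s.toFun :=
    SlabField.continuous_comp_toFun hΨ
  let g : SlabField (EuclideanSpace ℝ (Fin 3)) (EuclideanSpace ℝ (Fin 3)) 3 →ᵇ ℝ :=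
    BoundedContinuousFunction.mkOfBound ⟨fun s => Ψ s.toFun, hΨcont⟩ (|B| + |B|)
    (fun s s' => by
      show dist (Ψ s.toFun) (Ψ s'.toFun) ≤ |B| + |B|
      rw [Real.dist_eq]
      have h1 := hB s.toFun
      have h2 := hB s'.toFun
      have h3 : |Ψ s.toFun - Ψ s'.toFun| ≤ |Ψ s.toFun| + |Ψ s'.toFun| := abs_sub _ _
      have h4 : B ≤ |B| := le_abs_self B
      linarith)
  have hg : ∀ s, g s = Ψ s.toFun := fun s => rfl
  -- ## `Ψ` does not see null sets of the slab: `Ψ (w_c) = Ψ ((y.toFun)_c)`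
  have hΨnull : ∀ {c : ℝ}, 0 < c → Ψ (nsRescale c w) = Ψ (nsRescale c y.toFun) := by
    intro c hc
    have ht := rlNearIdentityDSS_ae_comp_dilation (F := fun z => y.toFun z.1 z.2)
      (G := fun z => w z.1 z.2) hc hyw
    have hzero : eLpNorm (fun z : ℝ × EuclideanSpace ℝ (Fin 3) =>
        nsRescale c w z.1 z.2 - nsRescale c y.toFun z.1 z.2) 3
        (volume.restrict (parabolicCylinder ((n : ℝ) + 1) (0 : ℝ × EuclideanSpace ℝ (Fin 3)))) = 0 := by
      refine (eLpNorm_congr_ae ?_).trans eLpNorm_zero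
      have hQ := ae_restrict_of_ae_restrict_of_subset
        (parabolicCylinder_origin_subset_slab ((n : ℝ) + 1)) ht
      filter_upwards [hQ] with z hz
      simp only [nsRescale_apply, Pi.zero_apply]
      rw [hz, sub_self]
    -- `|Ψ (w_c) - Ψ ((y.toFun)_c)| ≤ ε` for every `ε > 0`
    refine eq_of_abs_sub_nonpos (le_of_forall_pos_le_add fun ε hε => ?_)
    obtain ⟨δ, hδ, hδΨ⟩ := hΨ (nsRescale c y.toFun) ε hε
    have h := hδΨ (nsRescale c w) (by rw [hzero]; exact zero_le)
    linarith
  -- ## genericity of `y` along the backward unit steps, read through `g`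
  obtain ⟨c, hc⟩ := hgen g
  refine ⟨c, hc.congr fun N => ?_⟩
  congr 1
  refine Finset.sum_congr rfl fun k _ => ?_
  rw [hg]
  show Ψ (nsRescale (Real.exp (-(k : ℝ))) y.toFun) = Ψ (nsRescale (Real.exp (-(k : ℝ))) w)
  exact (hΨnull (Real.exp_pos _)).symm

end Summit.NavierStokesRegularity.NavierStokesRegularity.Theorems

end
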